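import Literature.NumberTheory.GaloisRepresentations.PrimaryGeneratorHeckeCharacter
import Literature.NumberTheory.GaloisRepresentations.KummerCubicCharacterConductor
import Literature.NumberTheory.GaloisRepresentations.RayElementsNorm
import Literature.NumberTheory.Automorphic.GaloisActionPlaces
import Mathlib.NumberTheory.NumberField.Cyclotomic.PID
import HarnessLib

/-!
# Primes, primary generators and the cubic symbol `(D/·)₃` of `ℚ(ω)` under the non-trivial automorphism — plumbing for the
# Hecke character of `y² = x³ + k` (Ireland–Rosen Ch. 9 §3, Ch. 18 §6)

Topic `Literature/NumberTheory/GaloisRepresentations`, namespace `Literature.NumberTheory.GaloisRepresentations.EisensteinSextic`.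
Definitions with bodies (`cubicLoc`, `varpi`) and THEOREMS; no instance, no notation, no named fact.  Prequel of
`EisensteinSexticHeckeCharacter` (the Größencharakter `𝔭 ↦ (k/N𝔭)(4k/𝔭)₃ ϖ_𝔭` of the sextic twists `E^k : y² = x³ + k`), for an abstract
`K ∋ ζ₃` (`{ζ : 𝓞 K} (hζ : IsPrimitiveRoot ζ 3)`; `IsCyclotomicExtension {3} ℚ K` where the arithmetic of `ℤ[ω]` is used).

* §0 `ℚ(ω)`-plumbing: `exists_prime_natCast_mem`, `not_dvd_absNorm_of_isCoprime` (`I` prime to `(p)` ⇒ `p ∤ N I`, by Cauchy in `𝓞 K ⧸ I`),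
  `absNorm_smul`/`residueCard_smul`, `algEquiv_eq_of_ne_one` (the non-trivial automorphism `c` is unique; Mathlib `galEquivZMod`),
  `embedding_algEquiv` (`e ∘ c = conj ∘ e`), `algebraMap_norm_eq` (`N x = x · c x`), `norm_int_nonneg`, ★ `absNorm_span_modEq`
  (`b ≡ c (mod m𝓞) ⇒ N((b)) ≡ N((c)) (mod m)`, from `RayElementsNorm.norm_sub_norm_mem_of_sub_mem_map`), `subsingleton_infinitePlace`;
* §1 `cubicLoc hζ D e : HeightOneSpectrum (𝓞 K) → ℂˣ` — the abstract-`K` twin of `EisensteinGrossen.psiLoc` (the local values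
  `kummerChar(Frob_v)` of `K(∛D)/K`, or `1` if `D` is a cube): `= e(χ_v(D))` at `v ∤ 3D` (`coe_cubicLoc_of_not_mem`), values in `μ₃`,
  ★ `artinSymbol_cubicLoc_span_eq_of_sub_mem` (the Artin symbol `S((b)) = (D/b)₃` is PERIODIC modulo `9D` on generators prime to `3D` —
  the tree's proved Artin reciprocity `artinSymbol_kummerChar_eq_of_sub_mem_span`), and the Galois equivariance ★ `cubicResidueSymbol_smul`
  (`χ_{c𝔭}(c a) = c χ_𝔭(a)`), `coe_cubicLoc_smul` (`(D/c𝔭)₃ = conj (D/𝔭)₃` in `ℂ` when `c D = D`);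
* §2 `varpi hζ v` — the primary generator `ϖ_v ≡ 1 (mod 3)` of `𝔭_v ∤ 3` (`PrimaryGeneratorHeckeCharacter.primaryGen` for `𝔣 = (3)`, the
  hypotheses discharged by `CubicJacobiSumPrimary`), `varpi_eq_of`, ★ `varpi_smul` (`ϖ_{c v} = c ϖ_v`), `embedding_varpi_smul`.

Nothing about BSD is proved here.

## References
* K. Ireland, M. Rosen, *A Classical Introduction to Modern Number Theory*, 2nd ed., GTM 84 (1990), Ch. 9 §1, §3 (Props. 9.3.2–9.3.5,
  Theorem 1), Ch. 18 §6 (proof of Theorem 7). [IrelandRosen1990]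
* J. Neukirch, *Algebraic Number Theory* (1999), Ch. I §3, Ch. VII §6. [NeukirchANT1999]

## Mathlib / tree search
Tree: `primaryGen`, `primarize`, `span_primaryGen`, `primaryGen_sub_one_mem`, `primaryGen_ne_zero`, `primarize_eq_of`, `isCoprime_span_generator`
(`PrimaryGeneratorHeckeCharacter`); `exists_units_mul_sub_one_mem_span_three`, `units_eq_one_of_sub_one_mem_span_three` (`CubicJacobiSumPrimary`);
`kummerChar`, `kummerChar_galFrob`, `kummerChar_pow_three`, `isGalois_kummerField`, `artinSymbol_kummerChar_eq_of_sub_mem_span`,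
`artinSymbol_pow_three_eq_one`, `cubicResidueSymbol_eq_one_of_cube` (`KummerCubicCharacterPeriodicity`); `cubicResidueSymbol_spec`,
`cubicResidueSymbol_eq_of_pow_three_eq_one`, `cubicResidueSymbol_zero`, `embedding_apply_eq_starRingEnd_of_ne` (`CubicResidueSymbol`);
`norm_sub_norm_mem_of_sub_mem_map` (`RayElementsNorm`); `LFunctions.AbelianDensity.{artinSymbol, artinSymbol_asIdeal}`;
`Automorphic.{RingOfIntegers.coe_algEquiv_smul, HeightOneSpectrum.smul_mem_smul_asIdeal_iff}` (`GaloisActionPlaces`); `CatalanJacobiSum.absNorm_smul`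
(copied, not imported).  Mathlib: `IsCyclotomicExtension.Rat.galEquivZMod`, `IsCyclotomicExtension.Rat.three_pid`, `IsCyclotomicExtension.isGalois`,
`Algebra.norm_eq_prod_automorphisms`, `Algebra.coe_norm_int`, `Ideal.absNorm_span_singleton`, `Ideal.absNorm_mem`, `Ideal.pointwise_smul_def`,
`exists_prime_addOrderOf_dvd_card`, `Ideal.finiteQuotientOfFreeOfNeBot`.
-/

noncomputable section

open NumberField IsDedekindDomain IsDedekindDomain.HeightOneSpectrum
open scoped ComplexConjugate Pointwise

namespace Literature.NumberTheory.GaloisRepresentations.EisensteinSextic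

open Literature.NumberTheory.GaloisRepresentations
open Literature.NumberTheory.LFunctions.AbelianDensity (artinSymbol artinSymbol_asIdeal)
open Literature.NumberTheory.Automorphic (RingOfIntegers.coe_algEquiv_smul HeightOneSpectrum.smul_mem_smul_asIdeal_iff)

variable {K : Type*} [Field K] [NumberField K] {ζ : 𝓞 K} (hζ : IsPrimitiveRoot ζ 3)

/-! ### §0 Plumbing on `K = ℚ(ω)`: the non-trivial automorphism, norms, places -/

section Plumbing

/-- Every prime `𝔭_v` of `𝓞 K` contains a rational prime (descend along the factorisation of `N𝔭_v ∈ 𝔭_v`). [cite: NeukirchANT1999, Ch. I §8 (primes of `𝓞_K` above a rational prime)] -/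
private theorem exists_prime_natCast_mem (v : HeightOneSpectrum (𝓞 K)) : ∃ p : ℕ, p.Prime ∧ (p : 𝓞 K) ∈ v.asIdeal := by
  have hN0 : Ideal.absNorm v.asIdeal ≠ 0 := by rw [Ne, Ideal.absNorm_eq_zero_iff]; exact v.ne_bot
  have key : ∀ n : ℕ, n ≠ 0 → (n : 𝓞 K) ∈ v.asIdeal → ∃ p : ℕ, p.Prime ∧ (p : 𝓞 K) ∈ v.asIdeal := by
    intro n
    induction n using UniqueFactorizationMonoid.induction_on_prime with
    | h₁ => intro h; exact absurd rfl h
    | h₂ u hu =>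
      intro _ hmem
      obtain rfl := Nat.isUnit_iff.mp hu
      exact absurd ((Ideal.eq_top_iff_one _).mpr (by exact_mod_cast hmem)) v.isPrime.ne_top
    | h₃ n p hn hp ih =>
      intro _ hmem
      rw [Nat.cast_mul] at hmem
      rcases v.isPrime.mem_or_mem hmem with h | h
      · exact ⟨p, Nat.prime_iff.mpr hp, h⟩
      · exact ih hn h
  exact key _ hN0 (Ideal.absNorm_mem v.asIdeal)

/-- **`p ∤ N(I)` for `I` prime to `(p)`** (`I ≠ 0`): `p` is a unit in the finite ring `𝓞 K ⧸ I` of order `N(I)`, so `(𝓞 K ⧸ I, +)` has no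
element of order `p` (Cauchy). [cite: NeukirchANT1999, Ch. I §6 (the absolute norm `𝔑(𝔞) = (𝓞 : 𝔞)`)] -/
theorem not_dvd_absNorm_of_isCoprime {I : Ideal (𝓞 K)} (hI0 : I ≠ ⊥) {p : ℕ} (hp : p.Prime)
    (hI : IsCoprime I (Ideal.span {(p : 𝓞 K)})) : ¬ p ∣ Ideal.absNorm I := by
  classical
  intro hdvd
  obtain ⟨a, ha, b, hb, hab⟩ := Submodule.mem_sup.mp
    ((Ideal.isCoprime_iff_sup_eq.mp hI).symm ▸ Submodule.mem_top : (1 : 𝓞 K) ∈ I ⊔ Ideal.span {(p : 𝓞 K)})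
  obtain ⟨t, rfl⟩ := Ideal.mem_span_singleton'.mp hb
  haveI : Finite (𝓞 K ⧸ I) := Ideal.finiteQuotientOfFreeOfNeBot I hI0
  letI := Fintype.ofFinite (𝓞 K ⧸ I)
  have hcard : p ∣ Fintype.card (𝓞 K ⧸ I) := by
    rwa [← Nat.card_eq_fintype_card, ← Submodule.cardQuot_apply, ← Ideal.absNorm_apply]
  haveI := Fact.mk hp
  obtain ⟨y, hy⟩ := exists_prime_addOrderOf_dvd_card p hcard
  have hpy : (p : 𝓞 K ⧸ I) * y = 0 := by rw [← nsmul_eq_mul, ← hy, addOrderOf_nsmul_eq_zero]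
  have hunit : Ideal.Quotient.mk I (t * p) = 1 := by
    have : t * (p : 𝓞 K) = 1 - a := by rw [← hab]; ring
    rw [this, map_sub, map_one, Ideal.Quotient.eq_zero_iff_mem.mpr ha, sub_zero]
  have hy0 : y = 0 := by
    rw [← one_mul y, ← hunit, map_mul, map_natCast, mul_assoc, hpy, mul_zero]
  rw [hy0, addOrderOf_zero] at hy
  exact hp.one_lt.ne hy

/-- Galois-conjugate ideals have the same norm (copy of the tree's `CatalanJacobiSum.absNorm_smul`, not imported). [cite: NeukirchANT1999, Ch. I §9 (conjugate prime ideals)] -/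
theorem absNorm_smul (c : K ≃ₐ[ℚ] K) (I : Ideal (𝓞 K)) : Ideal.absNorm (c • I) = Ideal.absNorm I := by
  let f : 𝓞 K ≃+* 𝓞 K := MulSemiringAction.toRingEquiv _ (𝓞 K) c
  have hf : c • I = I.map (f : 𝓞 K →+* 𝓞 K) := by rw [Ideal.pointwise_smul_def]; rfl
  rw [Ideal.absNorm_apply, Ideal.absNorm_apply, Submodule.cardQuot_apply, Submodule.cardQuot_apply]
  exact (Nat.card_congr (Ideal.quotientEquiv I (c • I) f hf).toEquiv).symm

/-- `N(c • 𝔭) = N𝔭`. [cite: NeukirchANT1999, Ch. I §9 (conjugate prime ideals)] -/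
theorem residueCard_smul (c : K ≃ₐ[ℚ] K) (v : HeightOneSpectrum (𝓞 K)) : (c • v).residueCard = v.residueCard := by
  show Ideal.absNorm (c • v).asIdeal = Ideal.absNorm v.asIdeal
  rw [Literature.NumberTheory.Automorphic.HeightOneSpectrum.smul_asIdeal, absNorm_smul]

/-- An automorphism fixes the integers: `c • n = n` in `𝓞 K`. [cite: IrelandRosen1990, Ch. 9 §1] -/
theorem smul_intCast (c : K ≃ₐ[ℚ] K) (n : ℤ) : c • ((n : ℤ) : 𝓞 K) = n := by
  apply RingOfIntegers.ext
  rw [RingOfIntegers.coe_algEquiv_smul ℚ]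
  exact map_intCast c n

/-- `n ∈ c • 𝔭 ↔ n ∈ 𝔭` for an integer `n`. [cite: IrelandRosen1990, Ch. 9 §1] -/
theorem intCast_mem_smul_iff (c : K ≃ₐ[ℚ] K) (v : HeightOneSpectrum (𝓞 K)) (n : ℤ) :
    ((n : ℤ) : 𝓞 K) ∈ (c • v).asIdeal ↔ ((n : ℤ) : 𝓞 K) ∈ v.asIdeal := by
  conv_lhs => rw [← smul_intCast c n]
  exact HeightOneSpectrum.smul_mem_smul_asIdeal_iff c v _

/-- `3 ∈ c • 𝔭 ↔ 3 ∈ 𝔭`. [cite: IrelandRosen1990, Ch. 9 §1] -/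
theorem three_mem_smul_iff (c : K ≃ₐ[ℚ] K) (v : HeightOneSpectrum (𝓞 K)) :
    (3 : 𝓞 K) ∈ (c • v).asIdeal ↔ (3 : 𝓞 K) ∈ v.asIdeal := by
  have h := intCast_mem_smul_iff c v 3
  rwa [Int.cast_ofNat] at h

/-- `c • (x) = (c • x)`. [cite: IrelandRosen1990, Ch. 9 §1] -/
theorem smul_span_singleton (c : K ≃ₐ[ℚ] K) (x : 𝓞 K) : c • (Ideal.span {x} : Ideal (𝓞 K)) = Ideal.span {c • x} := by
  rw [Ideal.pointwise_smul_def, Ideal.map_span, Set.image_singleton]; rfl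

/-- `(k, N𝔭) = 1` off `6k`: `N𝔭 = p^f` for the rational prime `p ∈ 𝔭`, and `p ∣ k` would put `6k` in `𝔭`. [cite: IrelandRosen1990, Ch. 18 §7 («if `P ∤ 6D`»: the Jacobi factor `(D/NP)` is `±1`)] -/
theorem gcd_absNorm_eq_one {k : ℤ} {v : HeightOneSpectrum (𝓞 K)} (h : ((6 * k : ℤ) : 𝓞 K) ∉ v.asIdeal) :
    k.gcd (Ideal.absNorm v.asIdeal : ℤ) = 1 := by
  obtain ⟨p, hp, hpv⟩ := exists_prime_natCast_mem v
  haveI := Fact.mk hp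
  haveI : v.asIdeal.IsMaximal := v.isMaximal
  haveI : v.asIdeal.LiesOver (Ideal.span {(p : ℤ)}) := by
    rw [Ideal.liesOver_iff]
    refine Ideal.IsMaximal.eq_of_le (Int.ideal_span_isMaximal_of_prime p) Ideal.IsPrime.ne_top' ?_
    rw [Ideal.span_singleton_le_iff_mem, Ideal.mem_comap, algebraMap_int_eq, map_natCast]
    exact hpv
  have hN : Ideal.absNorm v.asIdeal = p ^ v.asIdeal.inertiaDeg ℤ := (Ideal.pow_inertiaDeg p v.asIdeal).symm
  have hpk : ¬ (p : ℤ) ∣ k := by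
    rintro ⟨m, rfl⟩
    apply h
    have e : ((6 * ((p : ℤ) * m) : ℤ) : 𝓞 K) = ((6 * m : ℤ) : 𝓞 K) * (p : 𝓞 K) := by push_cast; ring
    rw [e]
    exact v.asIdeal.mul_mem_left _ hpv
  have hg : Int.gcd k p = 1 := by
    rw [Int.gcd_eq_natAbs, Int.natAbs_natCast]
    exact ((Nat.Prime.coprime_iff_not_dvd hp).mpr fun hd => hpk (Int.natCast_dvd.mpr hd)).symm
  have hcop : IsCoprime k ((p : ℤ) ^ v.asIdeal.inertiaDeg ℤ) := (Int.isCoprime_iff_gcd_eq_one.mpr hg).pow_right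
  rw [hN, Nat.cast_pow]
  exact Int.isCoprime_iff_gcd_eq_one.mp hcop

variable [IsCyclotomicExtension {3} ℚ K]

/-- **`ℚ(ω)` has exactly one non-trivial automorphism** (`Gal ≃ (ℤ/3)ˣ = {±1}`, Mathlib's `galEquivZMod`). [cite: IrelandRosen1990, Ch. 9 §1] -/
theorem algEquiv_eq_of_ne_one {c c' : K ≃ₐ[ℚ] K} (hc : c ≠ 1) (hc' : c' ≠ 1) : c = c' := by
  set g := IsCyclotomicExtension.Rat.galEquivZMod 3 K
  have key : ∀ u : (ZMod 3)ˣ, u = 1 ∨ u = -1 := by decide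
  have h1 : g c = -1 := (key (g c)).resolve_left fun h => hc (g.injective (by rw [h, map_one]))
  have h2 : g c' = -1 := (key (g c')).resolve_left fun h => hc' (g.injective (by rw [h, map_one]))
  exact g.injective (h1.trans h2.symm)

/-- There is a non-trivial automorphism of `ℚ(ω)`. [cite: IrelandRosen1990, Ch. 9 §1] -/
theorem exists_algEquiv_ne_one : ∃ c : K ≃ₐ[ℚ] K, c ≠ 1 := by
  set g := IsCyclotomicExtension.Rat.galEquivZMod 3 K
  refine ⟨g.symm (-1), fun h => ?_⟩
  have h1 : g (g.symm (-1)) = g 1 := by rw [h]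
  rw [MulEquiv.apply_symm_apply, map_one] at h1
  exact absurd h1 (by decide)

/-- **`e(c x) = conj (e x)`**: under any complex embedding the non-trivial automorphism is complex conjugation (`ℚ(ω)` has one infinite
place). [cite: IrelandRosen1990, Ch. 9 §1 (`ᾱ`)] -/
theorem embedding_algEquiv (e : K →+* ℂ) {c : K ≃ₐ[ℚ] K} (hc : c ≠ 1) (x : K) : e (c x) = conj (e x) := by
  have hne : e.comp c.toRingEquiv.toRingHom ≠ e := by
    intro h
    apply hc
    ext y
    exact e.injective (by simpa using congrArg (fun f : K →+* ℂ => f y) h)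
  have h := embedding_apply_eq_starRingEnd_of_ne hne x
  rw [h, starRingEnd_self_apply]
  rfl

open Classical in
/-- `Gal(ℚ(ω)/ℚ) = {1, c}`. [cite: IrelandRosen1990, Ch. 9 §1] -/
theorem univ_eq_pair {c : K ≃ₐ[ℚ] K} (hc : c ≠ 1) : (Finset.univ : Finset (K ≃ₐ[ℚ] K)) = {1, c} := by
  ext σ
  simp only [Finset.mem_univ, Finset.mem_insert, Finset.mem_singleton, true_iff]
  by_cases h : σ = 1
  · exact Or.inl h
  · exact Or.inr (algEquiv_eq_of_ne_one h hc)

/-- **`N(x) = x · c x`** (Mathlib `Algebra.norm_eq_prod_automorphisms` over `Gal = {1, c}`). [cite: IrelandRosen1990, Ch. 9 §1 (`Nα = αᾱ`)] -/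
theorem algebraMap_norm_eq {c : K ≃ₐ[ℚ] K} (hc : c ≠ 1) (x : K) : algebraMap ℚ K (Algebra.norm ℚ x) = x * c x := by
  classical
  haveI := IsCyclotomicExtension.isGalois {3} ℚ K
  rw [Algebra.norm_eq_prod_automorphisms ℚ x, univ_eq_pair hc, Finset.prod_pair (Ne.symm hc), AlgEquiv.one_apply]

/-- **`N(x) ≥ 0` on `ℤ[ω]`** (`N(a + bω) = a² − ab + b²`): `e(N x) = e(x) conj(e(x)) = |e(x)|²`. [cite: IrelandRosen1990, Ch. 9 §1] -/
private theorem norm_int_nonneg (x : 𝓞 K) : 0 ≤ Algebra.norm ℤ x := by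
  obtain ⟨c, hc⟩ := exists_algEquiv_ne_one (K := K)
  set φ : K →+* ℂ := (Classical.arbitrary (InfinitePlace K)).embedding
  have h1 : (φ (algebraMap ℚ K (Algebra.norm ℚ (x : K))) : ℂ) = ((Algebra.norm ℚ (x : K) : ℚ) : ℂ) := by
    rw [eq_ratCast, map_ratCast]
  have h2 : φ (algebraMap ℚ K (Algebra.norm ℚ (x : K))) = (Complex.normSq (φ x) : ℂ) := by
    rw [algebraMap_norm_eq hc, map_mul, embedding_algEquiv φ hc, Complex.mul_conj]
  have h3 : ((Algebra.norm ℤ x : ℤ) : ℂ) = (Complex.normSq (φ x) : ℂ) := by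
    rw [← h2, h1, ← Algebra.coe_norm_int]; norm_cast
  have h4 : ((Algebra.norm ℤ x : ℤ) : ℝ) = Complex.normSq (φ x) := by exact_mod_cast h3
  have h5 : (0 : ℝ) ≤ ((Algebra.norm ℤ x : ℤ) : ℝ) := h4 ▸ Complex.normSq_nonneg _
  exact_mod_cast h5

/-- `N((b)) = N_{K/ℚ}(b)` as an integer. [cite: IrelandRosen1990, Ch. 9 §1] -/
theorem natCast_absNorm_span (b : 𝓞 K) : ((Ideal.absNorm (Ideal.span {b}) : ℕ) : ℤ) = Algebra.norm ℤ b := by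
  rw [Ideal.absNorm_span_singleton, Int.natAbs_of_nonneg (norm_int_nonneg b)]

/-- **Congruent elements have congruent norms**: `b ≡ c (mod m𝓞_K) ⇒ N((b)) ≡ N((c)) (mod m)` (`RayElementsNorm.norm_sub_norm_mem_of_sub_mem_map`:
determinants of congruent multiplication matrices). [cite: IrelandRosen1990, Ch. 18 §6, proof of Theorem 7 («`χ(A)` depends only on `A` modulo the conductor»)] -/
theorem absNorm_span_modEq {b c : 𝓞 K} {m : ℕ} (h : b - c ∈ Ideal.span {((m : ℕ) : 𝓞 K)}) :
    Ideal.absNorm (Ideal.span {b}) ≡ Ideal.absNorm (Ideal.span {c}) [MOD m] := by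
  have h' : b - c ∈ (Ideal.span {(m : ℤ)} : Ideal ℤ).map (algebraMap ℤ (𝓞 K)) := by
    rw [Ideal.map_span, Set.image_singleton, map_natCast]; exact h
  have h2 := norm_sub_norm_mem_of_sub_mem_map (Ideal.span {(m : ℤ)}) h'
  rw [Ideal.mem_span_singleton] at h2
  rw [Nat.modEq_iff_dvd, natCast_absNorm_span, natCast_absNorm_span]
  exact dvd_sub_comm.mp h2

/-- `ℚ(ω)` has a single infinite place. [cite: IrelandRosen1990, Ch. 9 §1] -/
theorem subsingleton_infinitePlace : Subsingleton (InfinitePlace K) := by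
  apply Fintype.card_le_one_iff_subsingleton.mp
  rw [InfinitePlace.card_eq_nrRealPlaces_add_nrComplexPlaces,
    IsCyclotomicExtension.Rat.nrRealPlaces_eq_zero K (n := 3) (by norm_num),
    IsCyclotomicExtension.Rat.nrComplexPlaces_eq_totient_div_two 3 K, show Nat.totient 3 = 2 by decide]

end Plumbing

/-! ### §1 The cubic part: the Artin symbol of the Kummer character of `K(∛D)/K` -/

section Cubic

open Classical in
/-- **The local cubic values** `v ↦ kummerChar(Frob_v) ∈ ℂˣ` of `K(∛D)/K` (`= e(χ_v(D))` for `v ∤ 3D`), or `1` when `D` is a cube in `K` —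
the abstract-`K` twin of `EisensteinGrossen.psiLoc`. [cite: IrelandRosen1990, Ch. 9 §3 Prop. 9.3.3] -/
def cubicLoc (D : 𝓞 K) (e : K →+* ℂ) : HeightOneSpectrum (𝓞 K) → ℂˣ :=
  if hD : ∀ b : K, b ^ 3 ≠ (D : K) then
    haveI := isGalois_kummerField hζ hD
    fun v ↦ kummerChar hζ hD e (galFrob K (kummerField D) v)
  else fun _ ↦ 1

/-- The local values are cube roots of unity. [cite: IrelandRosen1990, Ch. 9 §3 Prop. 9.3.3 (a)] -/
theorem cubicLoc_pow_three (D : 𝓞 K) (e : K →+* ℂ) (v : HeightOneSpectrum (𝓞 K)) : cubicLoc hζ D e v ^ 3 = 1 := by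
  unfold cubicLoc
  split_ifs with hD
  · exact kummerChar_pow_three hζ hD _ _
  · simp

/-- **`cubicLoc D e v = e(χ_v(D))` for `v ∤ 3D`** (`kummerChar_galFrob`; in the cube case both sides are `1`,
`cubicResidueSymbol_eq_one_of_cube`). [cite: IrelandRosen1990, Ch. 9 §3 Prop. 9.3.2] -/
theorem coe_cubicLoc_of_not_mem {D : 𝓞 K} (e : K →+* ℂ) {v : HeightOneSpectrum (𝓞 K)} (hDv : D ∉ v.asIdeal)
    (h3v : (3 : 𝓞 K) ∉ v.asIdeal) :
    (cubicLoc hζ D e v : ℂ) = e (cubicResidueSymbol v (Ideal.Quotient.mk v.asIdeal D) : K) := by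
  unfold cubicLoc
  split_ifs with hD
  · haveI := isGalois_kummerField hζ hD
    exact kummerChar_galFrob hζ hD e v hDv h3v
  · push Not at hD
    obtain ⟨b, hb⟩ := hD
    rw [cubicResidueSymbol_eq_one_of_cube hζ hb v hDv h3v, Units.val_one]
    simp

/-- The Artin symbol `S(I) = ∏_v cubicLoc(v)^{ord_v I}` is a cube root of unity. [cite: IrelandRosen1990, Ch. 9 §3 Prop. 9.3.3 (a)] -/
theorem artinSymbol_cubicLoc_pow_three (D : 𝓞 K) (e : K →+* ℂ) (I : Ideal (𝓞 K)) : artinSymbol (cubicLoc hζ D e) I ^ 3 = 1 :=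
  artinSymbol_pow_three_eq_one (cubicLoc_pow_three hζ D e) I

/-- The Artin symbol of the trivial local data is trivial. [folklore] -/
private theorem artinSymbol_const_one (I : Ideal (𝓞 K)) : artinSymbol (fun _ : HeightOneSpectrum (𝓞 K) ↦ (1 : ℂˣ)) I = 1 := by
  unfold artinSymbol; simp

/-- ★ **Periodicity of `(D/·)₃` modulo `9D`** on principal ideals with generator prime to `3D`: for nonzero `b ≡ c (mod 9D)`, `c` prime to
`3D`, `S((b)) = S((c))` (`KummerCubicCharacterPeriodicity.artinSymbol_kummerChar_eq_of_sub_mem_span`, the tree's proved Artin reciprocity for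
`K(∛D)/K`). [cite: IrelandRosen1990, Ch. 9 §3 Theorem 1] -/
theorem artinSymbol_cubicLoc_span_eq_of_sub_mem {D : 𝓞 K} (e : K →+* ℂ) {b c : 𝓞 K} (hb : b ≠ 0) (hc : c ≠ 0)
    (hcop : IsCoprime (Ideal.span {c}) (Ideal.span {3 * D})) (hbc : b - c ∈ Ideal.span {9 * D}) :
    artinSymbol (cubicLoc hζ D e) (Ideal.span {b}) = artinSymbol (cubicLoc hζ D e) (Ideal.span {c}) := by
  unfold cubicLoc
  split_ifs with hD
  · haveI := isGalois_kummerField hζ hD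
    exact artinSymbol_kummerChar_eq_of_sub_mem_span hζ hD _ hb hc hcop hbc
  · rw [artinSymbol_const_one, artinSymbol_const_one]

include hζ in
/-- **Galois equivariance of the cubic residue symbol**: `χ_{c•𝔭}(c • a) = c • χ_𝔭(a)` (transport of Euler's criterion
`χ_𝔭(a) ≡ a^{(N𝔭−1)/3} (mod 𝔭)` along `c`; `N(c•𝔭) = N𝔭`). [cite: IrelandRosen1990, Ch. 9 §3 Prop. 9.3.2] -/
theorem cubicResidueSymbol_smul (c : K ≃ₐ[ℚ] K) {v : HeightOneSpectrum (𝓞 K)} (h3v : (3 : 𝓞 K) ∉ v.asIdeal) (a : 𝓞 K) :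
    cubicResidueSymbol (c • v) (Ideal.Quotient.mk (c • v).asIdeal (c • a)) = c • cubicResidueSymbol v (Ideal.Quotient.mk v.asIdeal a) := by
  have h3' : (3 : 𝓞 K) ∉ (c • v).asIdeal := fun h => h3v ((three_mem_smul_iff c v).mp h)
  by_cases ha : Ideal.Quotient.mk v.asIdeal a = 0
  · have ha' : Ideal.Quotient.mk (c • v).asIdeal (c • a) = 0 := by
      rw [Ideal.Quotient.eq_zero_iff_mem] at ha ⊢
      exact (HeightOneSpectrum.smul_mem_smul_asIdeal_iff c v a).mpr ha
    rw [ha, ha', cubicResidueSymbol_zero hζ, cubicResidueSymbol_zero hζ, smul_zero]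
  · obtain ⟨hμ3, hμ⟩ := cubicResidueSymbol_spec hζ h3v ha
    set μ := cubicResidueSymbol v (Ideal.Quotient.mk v.asIdeal a)
    refine cubicResidueSymbol_eq_of_pow_three_eq_one hζ h3' (μ := c • μ) ?_ ?_
    · rw [← smul_pow', hμ3, smul_one]
    · rw [residueCard_smul, ← map_pow, Ideal.Quotient.eq, ← smul_pow', ← smul_sub]
      rw [← map_pow, Ideal.Quotient.eq] at hμ
      exact (HeightOneSpectrum.smul_mem_smul_asIdeal_iff c v _).mpr hμ

variable [IsCyclotomicExtension {3} ℚ K]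

/-- **`cubicLoc D e (c • v) = conj (cubicLoc D e v)`** for `c ≠ 1`, `c • D = D` (e.g. `D ∈ ℤ`) and `v ∤ 3D`: `e ∘ c = conj ∘ e`.
[cite: IrelandRosen1990, Ch. 9 §3 Prop. 9.3.2; Ch. 18 §6 (proof of Theorem 7, `χ(Ā) = \overline{χ(A)}`)] -/
theorem coe_cubicLoc_smul (e : K →+* ℂ) {c : K ≃ₐ[ℚ] K} (hc : c ≠ 1) {D : 𝓞 K} (hD : c • D = D)
    {v : HeightOneSpectrum (𝓞 K)} (hDv : D ∉ v.asIdeal) (h3v : (3 : 𝓞 K) ∉ v.asIdeal) :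
    (cubicLoc hζ D e (c • v) : ℂ) = conj (cubicLoc hζ D e v : ℂ) := by
  have hDv' : D ∉ (c • v).asIdeal := fun h => hDv ((HeightOneSpectrum.smul_mem_smul_asIdeal_iff c v D).mp (by rwa [hD]))
  have h3' : (3 : 𝓞 K) ∉ (c • v).asIdeal := fun h => h3v ((three_mem_smul_iff c v).mp h)
  rw [coe_cubicLoc_of_not_mem hζ e hDv' h3', coe_cubicLoc_of_not_mem hζ e hDv h3v, ← embedding_algEquiv e hc,
    ← RingOfIntegers.coe_algEquiv_smul ℚ, ← cubicResidueSymbol_smul hζ c h3v D, hD]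

end Cubic

/-! ### §2 The primary generator `ϖ_v ≡ 1 (mod 3)` -/

section Varpi

variable [IsCyclotomicExtension {3} ℚ K]

include hζ in
/-- Hypothesis `hsurj` of `PrimaryGeneratorHeckeCharacter` for `𝔣 = (3)` (Ireland–Rosen Prop. 9.3.5). [cite: IrelandRosen1990, Ch. 9 §3 Prop. 9.3.5] -/
theorem hsurj_three : ∀ x : 𝓞 K, IsCoprime (Ideal.span {x}) (Ideal.span {(3 : 𝓞 K)}) →
    ∃ u : (𝓞 K)ˣ, (u : 𝓞 K) * x - 1 ∈ Ideal.span {(3 : 𝓞 K)} :=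
  fun x hx => exists_units_mul_sub_one_mem_span_three hζ x hx

include hζ in
/-- Hypothesis `hinj` of `PrimaryGeneratorHeckeCharacter` for `𝔣 = (3)`. [cite: IrelandRosen1990, Ch. 9 §3 Prop. 9.3.5] -/
theorem hinj_three : ∀ u : (𝓞 K)ˣ, (u : 𝓞 K) - 1 ∈ Ideal.span {(3 : 𝓞 K)} → u = 1 :=
  fun u hu => units_eq_one_of_sub_one_mem_span_three hζ u hu

/-- **The primary generator `ϖ_v`** of a prime `𝔭_v ∤ 3` of the principal ideal domain `ℤ[ω]`: `𝔭_v = (ϖ_v)`, `ϖ_v ≡ 1 (mod 3)`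
(`PrimaryGeneratorHeckeCharacter.primaryGen` for `𝔣 = (3)`; junk at `v ∣ 3`). [cite: IrelandRosen1990, Ch. 9 §3 Prop. 9.3.5] -/
def varpi (v : HeightOneSpectrum (𝓞 K)) : 𝓞 K :=
  haveI : IsPrincipalIdealRing (𝓞 K) := IsCyclotomicExtension.Rat.three_pid K
  primaryGen (hsurj_three hζ) v

omit [NumberField K] [IsCyclotomicExtension {3} ℚ K] in
/-- `3 ∉ 𝔭 ↔ (3) ∤ 𝔭`. [folklore] -/
private theorem not_span_three_le_iff {v : HeightOneSpectrum (𝓞 K)} : ¬ Ideal.span {(3 : 𝓞 K)} ≤ v.asIdeal ↔ (3 : 𝓞 K) ∉ v.asIdeal := by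
  rw [Ideal.span_singleton_le_iff_mem]

/-- `𝔭_v = (ϖ_v)`. [cite: IrelandRosen1990, Ch. 9 §3 Prop. 9.3.5] -/
theorem span_varpi {v : HeightOneSpectrum (𝓞 K)} (h3v : (3 : 𝓞 K) ∉ v.asIdeal) : Ideal.span {varpi hζ v} = v.asIdeal := by
  haveI : IsPrincipalIdealRing (𝓞 K) := IsCyclotomicExtension.Rat.three_pid K
  exact span_primaryGen (hsurj_three hζ) (not_span_three_le_iff.mpr h3v)

/-- `ϖ_v ≡ 1 (mod 3)`. [cite: IrelandRosen1990, Ch. 9 §3 Prop. 9.3.5] -/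
theorem varpi_sub_one_mem {v : HeightOneSpectrum (𝓞 K)} (h3v : (3 : 𝓞 K) ∉ v.asIdeal) :
    varpi hζ v - 1 ∈ Ideal.span {(3 : 𝓞 K)} := by
  haveI : IsPrincipalIdealRing (𝓞 K) := IsCyclotomicExtension.Rat.three_pid K
  exact primaryGen_sub_one_mem (hsurj_three hζ) (not_span_three_le_iff.mpr h3v)

/-- `ϖ_v ≠ 0`. [cite: IrelandRosen1990, Ch. 9 §3 Prop. 9.3.5] -/
theorem varpi_ne_zero {v : HeightOneSpectrum (𝓞 K)} (h3v : (3 : 𝓞 K) ∉ v.asIdeal) : varpi hζ v ≠ 0 := by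
  haveI : IsPrincipalIdealRing (𝓞 K) := IsCyclotomicExtension.Rat.three_pid K
  exact primaryGen_ne_zero (hsurj_three hζ) (not_span_three_le_iff.mpr h3v)

/-- **Characterisation**: a generator of `𝔭_v` which is `≡ 1 (mod 3)` IS `ϖ_v`. [cite: IrelandRosen1990, Ch. 9 §3 Prop. 9.3.5] -/
theorem varpi_eq_of {v : HeightOneSpectrum (𝓞 K)} (h3v : (3 : 𝓞 K) ∉ v.asIdeal) {x : 𝓞 K} (hx : Ideal.span {x} = v.asIdeal)
    (hx1 : x - 1 ∈ Ideal.span {(3 : 𝓞 K)}) : varpi hζ v = x := by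
  haveI : IsPrincipalIdealRing (𝓞 K) := IsCyclotomicExtension.Rat.three_pid K
  have hv := not_span_three_le_iff.mpr h3v
  refine primarize_eq_of (hsurj_three hζ) (hinj_three hζ) (isCoprime_span_generator hv) ?_ hx1
  rw [hx, Ideal.span_singleton_generator]

/-- **`ϖ_{c • v} = c • ϖ_v`** (`c` preserves `(3)` and the congruence `≡ 1`). [cite: IrelandRosen1990, Ch. 18 §6 (proof of Theorem 7)] -/
theorem varpi_smul (c : K ≃ₐ[ℚ] K) {v : HeightOneSpectrum (𝓞 K)} (h3v : (3 : 𝓞 K) ∉ v.asIdeal) :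
    varpi hζ (c • v) = c • varpi hζ v := by
  have h3' : (3 : 𝓞 K) ∉ (c • v).asIdeal := fun h => h3v ((three_mem_smul_iff c v).mp h)
  refine varpi_eq_of hζ h3' ?_ ?_
  · rw [← smul_span_singleton, span_varpi hζ h3v]; rfl
  · have h := varpi_sub_one_mem hζ h3v
    have h3 : c • (Ideal.span {(3 : 𝓞 K)} : Ideal (𝓞 K)) = Ideal.span {(3 : 𝓞 K)} := by
      rw [smul_span_singleton]
      have : c • (3 : 𝓞 K) = 3 := by have := smul_intCast c 3; rwa [Int.cast_ofNat] at this
      rw [this]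
    rw [← h3, show c • varpi hζ v - 1 = c • (varpi hζ v - 1) by rw [smul_sub, smul_one]]
    exact Ideal.smul_mem_pointwise_smul_iff.mpr h

/-- `e(ϖ_{c • v}) = conj (e(ϖ_v))` for `c ≠ 1`. [cite: IrelandRosen1990, Ch. 18 §6 (proof of Theorem 7)] -/
theorem embedding_varpi_smul (e : K →+* ℂ) {c : K ≃ₐ[ℚ] K} (hc : c ≠ 1) {v : HeightOneSpectrum (𝓞 K)}
    (h3v : (3 : 𝓞 K) ∉ v.asIdeal) : e (varpi hζ (c • v) : K) = conj (e (varpi hζ v : K)) := by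
  rw [varpi_smul hζ c h3v, RingOfIntegers.coe_algEquiv_smul ℚ, embedding_algEquiv e hc]

end Varpi

end Literature.NumberTheory.GaloisRepresentations.EisensteinSextic

end
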